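import Summits.QuantumFields.YangMills.Theorems.LuscherReductionTwistedTraceScalingInnerModelBlocks
import Summits.QuantumFields.YangMills.Theorems.TwistedTraceScaling.Negative.StiffGapCeiling
import HarnessLib

/-!
# R61 — THE TENSOR GAP HAS THE SAME CEILING: lane A's slow ⊗ stiff model is block-diagonal in the Hermite basis with blocks `λ_α · k`, its tensor-gap
# inequality is ATTAINED, and the tensor stiff constants are EXACTLY the fibre constants of R60 — the slow side gives nothing back (`θ₀ ≤ 1 − mehlerRatio g₀(L)`, no
# `L`-uniform `θ₀`, `θ₀ = 1/2` dead at `L = 9`, now in the full model of `hST`)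
(crux `LuscherReduction.TwistedTraceScaling`, stmt-QuantumFields-20203, skeleton «twolattice» rev 3, stub S-BASE, sub-target C4-CORE, bricks (B-ST) = field `hST` and (B-OD) =
field `hOD` of `RecordAnalyticInput` (✓ `…RecordAnalytic`); standing disprover, cycle 49; `Cruxes/TwistedTraceScaling/Disproof.lean` VERDICT 49)

Lane A's ★★★ `…MehlerTensorGap.abs_tensorForm_sub_slow_le` is the MODEL of the (B-T) + (B-ST) + (B-OD) split of the tube form: for the kernel `k(c,c')·K(q,q')` on
`C × ℝ^σ` (`k ≥ 0` symmetric with rows `≤ μ₁` = the slow kernel, `K = mehlerKernel a b` = the stiff fibre) and `Φ, Ψ ∈ L²`, `|T(Φ,Ψ) − λ₀ ∫∫ φ₀ k ψ₀| ≤ λ₀ ρ μ₁ · √(∫ orthSq Φ)·√(∫ orthSq Ψ)`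
for every `ρ ∈ [max_k r_k, 1]` (`φ₀ = slowCoeff Φ`, `r_k = b_k/(a_k+b_k+π)`).  R60 priced the FIBRE; this file prices the TENSOR statement (B-ST) is actually modelled on:
* §1–§2 product test functions `g ⊗ f` and the pure stiff excitation `g ⊗ hR e_{k₀}`, fibre-orthogonal to the ground state at EVERY slow point (`slowCoeff ≡ 0` pointwise —
  the exact model of `hST`'s hypothesis `∀ u, fibreInner … v u = 0`), with `orthSq = g²`;
* §3 ★★ `tensorForm_hermiteBlock` — `T(g ⊗ hR α, h ⊗ hR β) = δ_{αβ} λ_β ∫∫ g k h`: refining lane A's Born–Oppenheimer 2-block structure (`…InnerModelBlocks`: `T(PΦ,PΨ)` =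
  slow form, `T(PΦ, Ψ − PΨ) = 0`, stiff block `≤ λ₀ρμ₁‖·‖²`) to ALL Hermite levels, the model is BLOCK-DIAGONAL in `L²(C × ℝ^σ) = ⊕_α L²(C) ⊗ hR α` with blocks `λ_α · k`
  (`tensorForm_groundBlock`: the ground block is the slow form with ZERO remainder; `tensorForm_excBlock`: the first stiff block of mode `k₀` is `λ₀ r_{k₀} · k` — damped by
  `r_{k₀}` only, its slow factor still sees the WHOLE kernel; every off-diagonal block is `0`, so (B-OD)'s `b` is invisible in the model — its floor is R58's `β^{-s}`);
* §4 ★★ `tensorGap_necessary` — lane A's inequality at level `ρ` forces `r_{k₀}·⟨g, k g⟩ ≤ ρ μ₁ ‖g‖²` for EVERY slow `g ∈ L²(C)` and every mode; ★★ `tensorGap_fails_below` /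
  `tensorGap_iff` — for a Schur-EXACT kernel (constant rows `μ₁ > 0` on a finite `ν ≠ 0`: the slow kernel is Markov, its top state the constant) the inequality FAILS at every
  `ρ < r_{k₀}` and, for `0 ≤ ρ ≤ 1`, holds for all `Φ, Ψ` IFF `∀ k₀, r_{k₀} ≤ ρ` — the SAME threshold as the fibre's (`R60.mehlerGap_iff`); ★ `tensorGap_attained` — for a
  `μ₁`-eigenfunction `g` of `k` and `Φ = g ⊗ hR e_{k₀}` lane A's bound is an EQUALITY at `ρ = r_{k₀}`: neither the Schur factor `μ₁` nor the stiff factor can be shaved;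
* §5 ★★ `fibreStiff_of_tensorStiff` / `tensorStiff_of_le` / `tensorStiff_iff` — a tensor stiff constant `θ` (`slowCoeff Φ ≡ 0 ⇒ T(Φ,Φ) ≤ λ₀(1−θ)μ₁‖Φ‖²`, Schur-exact `k`) IS a
  fibre stiff constant of R60 (witness `1 ⊗ f`) and conversely (lane A at `ρ = min (1−θ) 1`): the admissible set is EXACTLY `(−∞, 1 − max_k r_k]`;
* §6 lattice normalisation (`r_k = mehlerRatio w_k`): ★★ `tensorStiff_le_vacuum : θ ≤ 2π/L + (2π/L)²` with a mode at `g₀(L) = 2 − 2cos(2π/L)`; ★★★ `no_uniform_tensorStiff` — for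
  every `θ > 0` an `L₀` beyond which EVERY Schur-exact slow model ⊗ EVERY normalised datum with a vacuum mode violates the clause; ★ `tensorStiff_half_fails` (`L ≥ 9`).

READING (disprover's ledger, cycle 49).  (i) The escape "the fibre ceiling of R60 might improve after tensoring with the slow kernel / under pointwise-in-`u` orthogonality" is
CLOSED in the model: `θ₀ = θ₀(L) ≤ 1 − mehlerRatio g₀(L) = O(1/L)` for the tensor clause `hST` abstracts (harmless at fixed `L₁`, S-BASE; the Feshbach absorption keeps its
`θ₀(L₁)` factor, `b² = Õ(β^{-2s}) = o(λ_b)` for `s > 1/6`, R58).  (ii) The model's off-diagonal blocks vanish identically, so it neither produces nor bounds (B-OD)'s `b` (floor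
`β^{-s}`, R58).  (iii) `tensorGap_attained`: lane A's ★★★ estimate is OPTIMAL in both factors — the route's analytic losses live in `κ` (`hκ_dom`, `β^{-2s}`) and `b` (R58), not in
the split.  Nothing here refutes a landed file; every theorem is about lane A's own model objects (`tensorForm`, `slowCoeff`, `orthSq`, `mehlerForm`, `hR`).
HONEST FRAMING: `L²` spectral bookkeeping (Hermite blocks of a slow ⊗ Mehler tensor kernel) about the constants of two bricks of a stub of a child of the CONDITIONAL reduction
route R2b1 (bears on R2b1 only); not `¬TwistedTraceScaling`, not infinite volume, not a mass gap, not Clay.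

## References
* M. Lüscher, *Some analytic results concerning the mass spectrum of Yang–Mills gauge theories on a torus*, Nucl. Phys. B219 (1983) 233–261, §3. [Luscher1983]
* B. Helffer, *Spectral Theory and its Applications*, CUP 2013, Lemma 7.1. [Helffer2013]
* G. B. Folland, *Harmonic Analysis in Phase Space*, Princeton UP 1989, §1.7 (vii). [Folland1989]
* A. Wipf, *Statistical Approach to Quantum Field Theory*, LNP 992, Springer 2021, §8.5.1 (8.57)–(8.58). [Wipf2021]
-/

set_option autoImplicit false

noncomputable section

open MeasureTheory Real Filter Topology
open scoped BigOperators

namespace Summit.QuantumFields.YangMills.Theorems.TwistedTraceScaling.Negative.R61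

open Summit.QuantumFields.YangMills.Theorems.FemtoTransferGap.Mehler
open Summit.QuantumFields.YangMills.Theorems.TwistedTraceScaling.Negative.R60 (prod_pow_single single_one_ne_zero
  hermCoeff_hR_single_zero integral_hR_sq mehlerForm_hR_single data_pos)

section FibreAlgebra

variable {C : Type*} {σ : Type*} [Fintype σ] [DecidableEq σ]

/-! ## §1 Slow ⊗ fibre product test functions `(g ⊗ f)(c,q) = g(c)·f(q)` -/

/-- The slow coefficient of `g ⊗ f` is `g · c₀(f)`. [folklore] -/
theorem slowCoeff_tensor (g : C → ℝ) (f : (σ → ℝ) → ℝ) (c : C) :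
    slowCoeff (fun p : C × (σ → ℝ) => g p.1 * f p.2) c = g c * hermCoeff f 0 := by
  unfold slowCoeff hermCoeff; rw [← integral_const_mul]; exact integral_congr_ae (ae_of_all _ fun q => by ring)

omit [DecidableEq σ] in
/-- The fibre norm of `g ⊗ f` is `g² · ‖f‖²`. [folklore] -/
theorem fibreSq_tensor (g : C → ℝ) (f : (σ → ℝ) → ℝ) (c : C) :
    fibreSq (fun p : C × (σ → ℝ) => g p.1 * f p.2) c = g c ^ 2 * ∫ q, f q ^ 2 := by
  unfold fibreSq; rw [← integral_const_mul]; exact integral_congr_ae (ae_of_all _ fun q => by ring)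

/-- The orthogonal part of `g ⊗ f` is `g² · (‖f‖² − c₀(f)²)`. [folklore] -/
theorem orthSq_tensor (g : C → ℝ) (f : (σ → ℝ) → ℝ) (c : C) :
    orthSq (fun p : C × (σ → ℝ) => g p.1 * f p.2) c = g c ^ 2 * ((∫ q, f q ^ 2) - hermCoeff f 0 ^ 2) := by
  rw [orthSq, fibreSq_tensor, slowCoeff_tensor]; ring

omit [DecidableEq σ] in
/-- The fibre Mehler form of product functions: `Q((g ⊗ f)(c,·), (h ⊗ f')(c',·)) = g(c) h(c') · Q(f,f')`. [folklore] -/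
theorem mehlerForm_tensor (a b : σ → ℝ) (g h : C → ℝ) (f f' : (σ → ℝ) → ℝ) (c c' : C) :
    mehlerForm a b (fun q => (fun p : C × (σ → ℝ) => g p.1 * f p.2) (c, q)) (fun q' => (fun p : C × (σ → ℝ) => h p.1 * f' p.2) (c', q')) =
      g c * h c' * mehlerForm a b f f' := by
  have e1 : (fun q => (fun p : C × (σ → ℝ) => g p.1 * f p.2) (c, q)) = g c • f := by funext q; simp
  have e2 : (fun q' => (fun p : C × (σ → ℝ) => h p.1 * f' p.2) (c', q')) = h c' • f' := by funext q; simp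
  rw [e1, e2, mehlerForm_smul_left, mehlerForm_smul_right, mul_assoc]

/-! ## §2 The pure stiff excitation `g ⊗ hR e_{k₀}` is fibre-orthogonal to the ground state at EVERY slow point -/

/-- `c₀((g ⊗ hR e_{k₀})(c,·)) = 0` for every `c` (not merely a.e.): the exact analogue of `hST`'s hypothesis `∀ u, fibreInner … v u = 0`. [cite: Folland1989, §1.7 (vii)] -/
theorem slowCoeff_exc (g : C → ℝ) (k₀ : σ) (c : C) : slowCoeff (fun p : C × (σ → ℝ) => g p.1 * hR (Finsupp.single k₀ 1 : σ →₀ ℕ) p.2) c = 0 := by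
  rw [slowCoeff_tensor, hermCoeff_hR_single_zero, mul_zero]

/-- `fibreSq (g ⊗ hR e_{k₀}) = g²`. [cite: Folland1989, §1.7 (vii)] -/
theorem fibreSq_exc (g : C → ℝ) (k₀ : σ) (c : C) : fibreSq (fun p : C × (σ → ℝ) => g p.1 * hR (Finsupp.single k₀ 1 : σ →₀ ℕ) p.2) c = g c ^ 2 := by
  rw [fibreSq_tensor, integral_hR_sq, mul_one]

/-- `orthSq (g ⊗ hR e_{k₀}) = g²`: the excitation is entirely fibre-orthogonal. [cite: Folland1989, §1.7 (vii)] -/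
theorem orthSq_exc (g : C → ℝ) (k₀ : σ) (c : C) : orthSq (fun p : C × (σ → ℝ) => g p.1 * hR (Finsupp.single k₀ 1 : σ →₀ ℕ) p.2) c = g c ^ 2 := by
  rw [orthSq, fibreSq_exc, slowCoeff_exc]; ring

end FibreAlgebra

variable {C : Type*} [MeasurableSpace C] {ν : Measure C} [SFinite ν]
variable {σ : Type*} [Fintype σ] [DecidableEq σ]

omit [DecidableEq σ] in
/-- `‖g ⊗ f‖² = ‖g‖²·‖f‖²`. [folklore] -/
theorem integral_tensor_sq (g : C → ℝ) (f : (σ → ℝ) → ℝ) :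
    ∫ p, (g p.1 * f p.2) ^ 2 ∂(ν.prod volume) = (∫ c, g c ^ 2 ∂ν) * ∫ q, f q ^ 2 := by
  have h : ∀ p : C × (σ → ℝ), (g p.1 * f p.2) ^ 2 = g p.1 ^ 2 * f p.2 ^ 2 := fun p => by ring
  simp_rw [h]; exact integral_prod_mul (fun c => g c ^ 2) (fun q => f q ^ 2)

/-- `‖g ⊗ hR e_{k₀}‖² = ‖g‖²`. [cite: Folland1989, §1.7 (vii)] -/
theorem integral_exc_sq (g : C → ℝ) (k₀ : σ) :
    ∫ p, (g p.1 * hR (Finsupp.single k₀ 1 : σ →₀ ℕ) p.2) ^ 2 ∂(ν.prod volume) = ∫ c, g c ^ 2 ∂ν := by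
  rw [integral_tensor_sq, integral_hR_sq, mul_one]

omit [DecidableEq σ] in
/-- `‖Φ‖² = ∫ fibreSq Φ` for `Φ ∈ L²(C × ℝ^σ)` (Fubini). [folklore] -/
theorem integral_sq_eq_integral_fibreSq {Φ : C × (σ → ℝ) → ℝ} (hΦ : MemLp Φ 2 (ν.prod volume)) :
    ∫ p, Φ p ^ 2 ∂(ν.prod volume) = ∫ c, fibreSq Φ c ∂ν := by
  rw [integral_prod _ hΦ.integrable_sq]; rfl

section Blocks

variable {k : C → C → ℝ} {a b : σ → ℝ} {μ₁ : ℝ}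

/-! ## §3 The model is block-diagonal in the Hermite basis, with blocks `λ_α · k` -/

omit [DecidableEq σ] in
/-- ★ **The tensor form of product functions**: `T(g ⊗ f, h ⊗ f') = Q(f,f') · ∫∫ g(c) k(c,c') h(c')`. [cite: Luscher1983, §3] -/
theorem tensorForm_tensor (ha : ∀ i, 0 < a i) (hb : ∀ i, 0 ≤ b i) (hk0 : ∀ c c', 0 ≤ k c c') (hksymm : ∀ c c', k c c' = k c' c)
    (hkm : Measurable (Function.uncurry k)) (hkint : ∀ c, Integrable (k c) ν) (hkrow : ∀ c, ∫ c', k c c' ∂ν ≤ μ₁)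
    {g h : C → ℝ} (hg : MemLp g 2 ν) (hh : MemLp h 2 ν) {f f' : (σ → ℝ) → ℝ} (hf : MemLp f 2 (volume : Measure (σ → ℝ)))
    (hf' : MemLp f' 2 (volume : Measure (σ → ℝ))) :
    tensorForm ν k a b (fun p : C × (σ → ℝ) => g p.1 * f p.2) (fun p : C × (σ → ℝ) => h p.1 * f' p.2) =
      mehlerForm a b f f' * ∫ c, ∫ c', g c * k c c' * h c' ∂ν ∂ν := by
  rw [tensorForm_eq_integral_fibre ha hb hk0 hksymm hkm hkint hkrow (memLp_prod_mul hg hf) (memLp_prod_mul hh hf')]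
  simp_rw [mehlerForm_tensor]; rw [← integral_const_mul]
  refine integral_congr_ae (ae_of_all _ fun c => ?_); dsimp only
  rw [← integral_const_mul]; exact integral_congr_ae (ae_of_all _ fun c' => by ring)

/-- ★★ **Hermite block-diagonality of the model**: `T(g ⊗ hR α, h ⊗ hR β) = δ_{αβ} · λ_β · ∫∫ g k h`, `λ_β = λ₀ Π r_i^{β_i}`: in the decomposition
`L²(C × ℝ^σ) = ⊕_α L²(C) ⊗ hR α` the model transfer form is block-diagonal with blocks `λ_α · k` — EVERY Hermite level carries the FULL slow kernel.
[cite: Luscher1983, §3] [cite: Folland1989, §1.7 (vii)] -/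
theorem tensorForm_hermiteBlock (ha : ∀ i, 0 < a i) (hb : ∀ i, 0 < b i) (hab : ∀ i, a i ^ 2 + 2 * a i * b i = π ^ 2)
    (hk0 : ∀ c c', 0 ≤ k c c') (hksymm : ∀ c c', k c c' = k c' c) (hkm : Measurable (Function.uncurry k)) (hkint : ∀ c, Integrable (k c) ν)
    (hkrow : ∀ c, ∫ c', k c c' ∂ν ≤ μ₁) {g h : C → ℝ} (hg : MemLp g 2 ν) (hh : MemLp h 2 ν) (α β : σ →₀ ℕ) :
    tensorForm ν k a b (fun p : C × (σ → ℝ) => g p.1 * hR α p.2) (fun p : C × (σ → ℝ) => h p.1 * hR β p.2) =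
      (if α = β then (∏ i, Real.sqrt (π / (a i + b i + π))) * ∏ i, (b i / (a i + b i + π)) ^ (β i) else 0) *
        ∫ c, ∫ c', g c * k c c' * h c' ∂ν ∂ν := by
  obtain ⟨hs, -, -⟩ := data_pos ha hb
  rw [tensorForm_tensor ha (fun i => (hb i).le) hk0 hksymm hkm hkint hkrow hg hh (memLp_hR α) (memLp_hR β), mehlerForm_hR_hR hs hab]

/-- The ground block is the slow form itself: `T(g ⊗ hR 0, h ⊗ hR 0) = λ₀ ∫∫ g k h` (lane A's leading term, with ZERO remainder). [cite: Luscher1983, §3] -/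
theorem tensorForm_groundBlock (ha : ∀ i, 0 < a i) (hb : ∀ i, 0 < b i) (hab : ∀ i, a i ^ 2 + 2 * a i * b i = π ^ 2)
    (hk0 : ∀ c c', 0 ≤ k c c') (hksymm : ∀ c c', k c c' = k c' c) (hkm : Measurable (Function.uncurry k)) (hkint : ∀ c, Integrable (k c) ν)
    (hkrow : ∀ c, ∫ c', k c c' ∂ν ≤ μ₁) {g h : C → ℝ} (hg : MemLp g 2 ν) (hh : MemLp h 2 ν) :
    tensorForm ν k a b (fun p : C × (σ → ℝ) => g p.1 * hR (0 : σ →₀ ℕ) p.2) (fun p : C × (σ → ℝ) => h p.1 * hR (0 : σ →₀ ℕ) p.2) =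
      (∏ i, Real.sqrt (π / (a i + b i + π))) * ∫ c, ∫ c', g c * k c c' * h c' ∂ν ∂ν := by
  rw [tensorForm_hermiteBlock ha hb hab hk0 hksymm hkm hkint hkrow hg hh, if_pos rfl]; simp

/-- ★★ **The first stiff block of mode `k₀`**: `T(g ⊗ hR e_{k₀}, h ⊗ hR e_{k₀}) = λ₀ · r_{k₀} · ∫∫ g k h` — the stiff excitation is damped by `r_{k₀}` ONLY; its slow
factor still sees the whole kernel `k`. [cite: Luscher1983, §3] [cite: Wipf2021, §8.5.1 (8.58)] -/
theorem tensorForm_excBlock (ha : ∀ i, 0 < a i) (hb : ∀ i, 0 < b i) (hab : ∀ i, a i ^ 2 + 2 * a i * b i = π ^ 2)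
    (hk0 : ∀ c c', 0 ≤ k c c') (hksymm : ∀ c c', k c c' = k c' c) (hkm : Measurable (Function.uncurry k)) (hkint : ∀ c, Integrable (k c) ν)
    (hkrow : ∀ c, ∫ c', k c c' ∂ν ≤ μ₁) {g h : C → ℝ} (hg : MemLp g 2 ν) (hh : MemLp h 2 ν) (k₀ : σ) :
    tensorForm ν k a b (fun p : C × (σ → ℝ) => g p.1 * hR (Finsupp.single k₀ 1 : σ →₀ ℕ) p.2)
        (fun p : C × (σ → ℝ) => h p.1 * hR (Finsupp.single k₀ 1 : σ →₀ ℕ) p.2) =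
      (∏ i, Real.sqrt (π / (a i + b i + π))) * (b k₀ / (a k₀ + b k₀ + π)) * ∫ c, ∫ c', g c * k c c' * h c' ∂ν ∂ν := by
  rw [tensorForm_hermiteBlock ha hb hab hk0 hksymm hkm hkint hkrow hg hh, if_pos rfl, prod_pow_single (fun i => b i / (a i + b i + π)) k₀]

end Blocks

/-! ## §4 ★★ Sharpness of lane A's tensor gap: the slow side gives NOTHING back -/

section Sharpness

variable {k : C → C → ℝ} {a b : σ → ℝ} {μ₁ ρ : ℝ}

/-- ★★ **NECESSARY CONDITION for the tensor gap.**  If the conclusion of lane A's `…MehlerTensorGap.abs_tensorForm_sub_slow_le` holds at level `ρ` for ALL real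
`Φ, Ψ ∈ L²(C × ℝ^σ)`, then for every slow factor `g ∈ L²(C)` and every stiff mode `k₀`:
`r_{k₀} · ∫∫ g(c) k(c,c') g(c') ≤ ρ · μ₁ · ‖g‖²` — i.e. `ρ ≥ r_{k₀} · ⟨g, k g⟩/(μ₁‖g‖²)`: the Schur constant `μ₁` must dominate the FORM of `k` on every `g`, with no help from
the stiff damping beyond the single factor `r_{k₀}` (witness `Φ = Ψ = g ⊗ hR e_{k₀}`). [cite: Luscher1983, §3] [cite: Wipf2021, §8.5.1 (8.58)] -/
theorem tensorGap_necessary (ha : ∀ i, 0 < a i) (hb : ∀ i, 0 < b i) (hab : ∀ i, a i ^ 2 + 2 * a i * b i = π ^ 2)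
    (hk0 : ∀ c c', 0 ≤ k c c') (hksymm : ∀ c c', k c c' = k c' c) (hkm : Measurable (Function.uncurry k)) (hkint : ∀ c, Integrable (k c) ν)
    (hkrow : ∀ c, ∫ c', k c c' ∂ν ≤ μ₁)
    (hgap : ∀ Φ Ψ : C × (σ → ℝ) → ℝ, MemLp Φ 2 (ν.prod volume) → MemLp Ψ 2 (ν.prod volume) →
      |tensorForm ν k a b Φ Ψ - (∏ i, Real.sqrt (π / (a i + b i + π))) * ∫ c, ∫ c', slowCoeff Φ c * k c c' * slowCoeff Ψ c' ∂ν ∂ν| ≤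
        (∏ i, Real.sqrt (π / (a i + b i + π))) * ρ * μ₁ * (Real.sqrt (∫ c, orthSq Φ c ∂ν) * Real.sqrt (∫ c, orthSq Ψ c ∂ν)))
    {g : C → ℝ} (hg : MemLp g 2 ν) (k₀ : σ) :
    b k₀ / (a k₀ + b k₀ + π) * ∫ c, ∫ c', g c * k c c' * g c' ∂ν ∂ν ≤ ρ * μ₁ * ∫ c, g c ^ 2 ∂ν := by
  obtain ⟨-, hL, hr⟩ := data_pos ha hb
  set L := ∏ i, Real.sqrt (π / (a i + b i + π)) with hLdef
  have h := hgap _ _ (memLp_prod_mul hg (memLp_hR (Finsupp.single k₀ 1 : σ →₀ ℕ))) (memLp_prod_mul hg (memLp_hR (Finsupp.single k₀ 1 : σ →₀ ℕ)))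
  rw [tensorForm_excBlock ha hb hab hk0 hksymm hkm hkint hkrow hg hg k₀] at h
  simp only [slowCoeff_exc, orthSq_exc, zero_mul, integral_zero, mul_zero, sub_zero] at h
  have hI : 0 ≤ ∫ c, g c ^ 2 ∂ν := integral_nonneg fun c => sq_nonneg _
  rw [Real.mul_self_sqrt hI] at h
  have h'' : L * (b k₀ / (a k₀ + b k₀ + π) * ∫ c, ∫ c', g c * k c c' * g c' ∂ν ∂ν) ≤ L * (ρ * μ₁ * ∫ c, g c ^ 2 ∂ν) := by
    simpa only [mul_assoc] using (le_abs_self _).trans h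
  exact le_of_mul_le_mul_left h'' hL

/-- ★★ **THE TENSOR GAP FAILS BELOW `r_{k₀}` for Schur-exact kernels.**  On a finite measure space `ν ≠ 0` with a kernel of CONSTANT row sums `μ₁ > 0` (the physical case: the
slow kernel is Markov and the slow ground state is the constant), lane A's tensor-gap inequality is FALSE at every level `ρ < r_{k₀}` (witness `Φ = Ψ = 1 ⊗ hR e_{k₀}`):
the constant cannot be improved from the slow side. [cite: Luscher1983, §3] [cite: Wipf2021, §8.5.1 (8.58)] -/
theorem tensorGap_fails_below [IsFiniteMeasure ν] [NeZero ν] (ha : ∀ i, 0 < a i) (hb : ∀ i, 0 < b i) (hab : ∀ i, a i ^ 2 + 2 * a i * b i = π ^ 2)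
    (hk0 : ∀ c c', 0 ≤ k c c') (hksymm : ∀ c c', k c c' = k c' c) (hkm : Measurable (Function.uncurry k)) (hkint : ∀ c, Integrable (k c) ν)
    (hμ₁ : 0 < μ₁) (hkrow : ∀ c, ∫ c', k c c' ∂ν = μ₁) (k₀ : σ) (hρ : ρ < b k₀ / (a k₀ + b k₀ + π)) :
    ¬ ∀ Φ Ψ : C × (σ → ℝ) → ℝ, MemLp Φ 2 (ν.prod volume) → MemLp Ψ 2 (ν.prod volume) →
      |tensorForm ν k a b Φ Ψ - (∏ i, Real.sqrt (π / (a i + b i + π))) * ∫ c, ∫ c', slowCoeff Φ c * k c c' * slowCoeff Ψ c' ∂ν ∂ν| ≤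
        (∏ i, Real.sqrt (π / (a i + b i + π))) * ρ * μ₁ * (Real.sqrt (∫ c, orthSq Φ c ∂ν) * Real.sqrt (∫ c, orthSq Ψ c ∂ν)) := by
  intro hgap
  have h := tensorGap_necessary ha hb hab hk0 hksymm hkm hkint (fun c => (hkrow c).le) hgap (memLp_const (1 : ℝ)) k₀
  simp only [one_mul, mul_one, one_pow, hkrow, integral_const, smul_eq_mul] at h
  have h2 : b k₀ / (a k₀ + b k₀ + π) * (ν.real Set.univ * μ₁) ≤ ρ * (ν.real Set.univ * μ₁) := by
    simpa only [mul_assoc, mul_comm μ₁] using h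
  exact absurd (le_of_mul_le_mul_right h2 (mul_pos (measureReal_univ_pos (μ := ν)) hμ₁)) (not_le.mpr hρ)

/-- ★★ **CHARACTERISATION of the admissible tensor constants (Schur-exact kernels).**  For `0 ≤ ρ ≤ 1`, a finite `ν ≠ 0` and constant row sums `μ₁ > 0`: lane A's tensor-gap
inequality holds for ALL `Φ, Ψ ∈ L²(C × ℝ^σ)` IFF `r_{k₀} ≤ ρ` for every mode — EXACTLY the fibre condition of `R60.mehlerGap_iff`; tensoring with the slow kernel moves the
threshold by NOTHING (`⇐` is lane A's `abs_tensorForm_sub_slow_le`). [cite: Luscher1983, §3] [cite: Helffer2013, Lemma 7.1] [cite: Wipf2021, §8.5.1 (8.58)] -/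
theorem tensorGap_iff [IsFiniteMeasure ν] [NeZero ν] (ha : ∀ i, 0 < a i) (hb : ∀ i, 0 < b i) (hab : ∀ i, a i ^ 2 + 2 * a i * b i = π ^ 2)
    (hk0 : ∀ c c', 0 ≤ k c c') (hksymm : ∀ c c', k c c' = k c' c) (hkm : Measurable (Function.uncurry k)) (hkint : ∀ c, Integrable (k c) ν)
    (hμ₁ : 0 < μ₁) (hkrow : ∀ c, ∫ c', k c c' ∂ν = μ₁) (hρ0 : 0 ≤ ρ) (hρ1 : ρ ≤ 1) :
    (∀ Φ Ψ : C × (σ → ℝ) → ℝ, MemLp Φ 2 (ν.prod volume) → MemLp Ψ 2 (ν.prod volume) →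
      |tensorForm ν k a b Φ Ψ - (∏ i, Real.sqrt (π / (a i + b i + π))) * ∫ c, ∫ c', slowCoeff Φ c * k c c' * slowCoeff Ψ c' ∂ν ∂ν| ≤
        (∏ i, Real.sqrt (π / (a i + b i + π))) * ρ * μ₁ * (Real.sqrt (∫ c, orthSq Φ c ∂ν) * Real.sqrt (∫ c, orthSq Ψ c ∂ν))) ↔
    ∀ k₀, b k₀ / (a k₀ + b k₀ + π) ≤ ρ := by
  constructor
  · intro h k₀
    by_contra hk
    exact tensorGap_fails_below ha hb hab hk0 hksymm hkm hkint hμ₁ hkrow k₀ (not_le.mp hk) h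
  · intro hr Φ Ψ hΦ hΨ
    exact abs_tensorForm_sub_slow_le ha hb hab hρ0 hr hρ1 hk0 hksymm hkm hkint hμ₁.le (fun c => (hkrow c).le) hΦ hΨ

/-- ★ **Lane A's remainder estimate is ATTAINED.**  For a slow factor `g ∈ L²(C)` that is a `μ₁`-eigenfunction of the kernel (`∫ k(c,c') g(c') = μ₁ g(c)`; for a Schur-exact
kernel: `g = 1`) and the excitation `Φ = g ⊗ hR e_{k₀}`: `|T(Φ,Φ) − λ₀ S(Φ,Φ)| = λ₀ · r_{k₀} · μ₁ · √(∫ orthSq Φ)·√(∫ orthSq Φ)` — EQUALITY in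
`abs_tensorForm_sub_slow_le` at `ρ = r_{k₀}`: neither the Schur factor `μ₁` nor the stiff factor `ρ` can be shaved. [cite: Luscher1983, §3] [cite: Helffer2013, Lemma 7.1] -/
theorem tensorGap_attained (ha : ∀ i, 0 < a i) (hb : ∀ i, 0 < b i) (hab : ∀ i, a i ^ 2 + 2 * a i * b i = π ^ 2)
    (hk0 : ∀ c c', 0 ≤ k c c') (hksymm : ∀ c c', k c c' = k c' c) (hkm : Measurable (Function.uncurry k)) (hkint : ∀ c, Integrable (k c) ν)
    (hμ₁ : 0 ≤ μ₁) (hkrow : ∀ c, ∫ c', k c c' ∂ν ≤ μ₁) {g : C → ℝ} (hg : MemLp g 2 ν) (heig : ∀ c, ∫ c', k c c' * g c' ∂ν = μ₁ * g c) (k₀ : σ) :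
    |tensorForm ν k a b (fun p : C × (σ → ℝ) => g p.1 * hR (Finsupp.single k₀ 1 : σ →₀ ℕ) p.2)
          (fun p : C × (σ → ℝ) => g p.1 * hR (Finsupp.single k₀ 1 : σ →₀ ℕ) p.2) -
        (∏ i, Real.sqrt (π / (a i + b i + π))) *
          ∫ c, ∫ c', slowCoeff (fun p : C × (σ → ℝ) => g p.1 * hR (Finsupp.single k₀ 1 : σ →₀ ℕ) p.2) c * k c c' *
            slowCoeff (fun p : C × (σ → ℝ) => g p.1 * hR (Finsupp.single k₀ 1 : σ →₀ ℕ) p.2) c' ∂ν ∂ν| =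
      (∏ i, Real.sqrt (π / (a i + b i + π))) * (b k₀ / (a k₀ + b k₀ + π)) * μ₁ *
        (Real.sqrt (∫ c, orthSq (fun p : C × (σ → ℝ) => g p.1 * hR (Finsupp.single k₀ 1 : σ →₀ ℕ) p.2) c ∂ν) *
          Real.sqrt (∫ c, orthSq (fun p : C × (σ → ℝ) => g p.1 * hR (Finsupp.single k₀ 1 : σ →₀ ℕ) p.2) c ∂ν)) := by
  obtain ⟨-, hL, hr⟩ := data_pos ha hb
  rw [tensorForm_excBlock ha hb hab hk0 hksymm hkm hkint hkrow hg hg k₀]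
  simp only [slowCoeff_exc, orthSq_exc, zero_mul, integral_zero, mul_zero, sub_zero]
  have hI : 0 ≤ ∫ c, g c ^ 2 ∂ν := integral_nonneg fun c => sq_nonneg _
  rw [Real.mul_self_sqrt hI]
  -- the slow double integral of an eigenfunction: `∫∫ g k g = μ₁ ‖g‖²`
  have hin : ∀ c, ∫ c', g c * k c c' * g c' ∂ν = μ₁ * g c ^ 2 := fun c => by
    rw [show (fun c' => g c * k c c' * g c') = fun c' => g c * (k c c' * g c') from funext fun c' => by ring, integral_const_mul, heig c]; ring
  simp_rw [hin]
  rw [integral_const_mul, abs_of_nonneg (mul_nonneg (mul_nonneg hL.le (hr k₀).le) (mul_nonneg hμ₁ hI))]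
  ring

end Sharpness

/-! ## §5 ★★ The model STIFF clause of the tensor: its constants are EXACTLY the fibre constants of R60 -/

section Stiff

variable {k : C → C → ℝ} {a b : σ → ℝ} {μ₁ θ : ℝ}

/-- ★★ **FIBRE REDUCTION of a tensor stiff constant (Schur-exact kernels).**  If `θ` is a stiff constant of the TENSOR model — every `Φ ∈ L²(C × ℝ^σ)` that is
fibre-orthogonal to the ground state at EVERY slow point (`∀ c, c₀(Φ(c,·)) = 0`, the model of `hST`'s hypothesis) obeys `T(Φ,Φ) ≤ λ₀(1−θ)μ₁‖Φ‖²` — then `θ` is a stiff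
constant of the FIBRE in the sense of R60 (`c₀(f) = 0 ⇒ Q(f,f) ≤ λ₀(1−θ)‖f‖²`); witness `Φ = 1 ⊗ f`.  Hence ALL of R60's ceilings apply verbatim to (B-ST)'s tensor constant.
[cite: Luscher1983, §3] [cite: Wipf2021, §8.5.1 (8.58)] -/
theorem fibreStiff_of_tensorStiff [IsFiniteMeasure ν] [NeZero ν] (ha : ∀ i, 0 < a i) (hb : ∀ i, 0 ≤ b i)
    (hk0 : ∀ c c', 0 ≤ k c c') (hksymm : ∀ c c', k c c' = k c' c) (hkm : Measurable (Function.uncurry k)) (hkint : ∀ c, Integrable (k c) ν)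
    (hμ₁ : 0 < μ₁) (hkrow : ∀ c, ∫ c', k c c' ∂ν = μ₁)
    (hst : ∀ Φ : C × (σ → ℝ) → ℝ, MemLp Φ 2 (ν.prod volume) → (∀ c, slowCoeff Φ c = 0) →
      tensorForm ν k a b Φ Φ ≤ (∏ i, Real.sqrt (π / (a i + b i + π))) * (1 - θ) * μ₁ * ∫ p, Φ p ^ 2 ∂(ν.prod volume))
    {f : (σ → ℝ) → ℝ} (hf : MemLp f 2 (volume : Measure (σ → ℝ))) (hf0 : hermCoeff f 0 = 0) :
    mehlerForm a b f f ≤ (∏ i, Real.sqrt (π / (a i + b i + π))) * (1 - θ) * ∫ x, f x ^ 2 := by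
  have h := hst _ (memLp_prod_mul (memLp_const (1 : ℝ)) hf) (fun c => by simp only [slowCoeff, one_mul]; exact hf0)
  rw [tensorForm_tensor ha hb hk0 hksymm hkm hkint (fun c => (hkrow c).le) (memLp_const (1 : ℝ)) (memLp_const (1 : ℝ)) hf hf] at h
  simp only [one_mul, mul_one, hkrow, integral_const, smul_eq_mul] at h
  have e2 : ∫ p : C × (σ → ℝ), f p.2 ^ 2 ∂(ν.prod volume) = ν.real Set.univ * ∫ q, f q ^ 2 := by
    rw [integral_fun_snd (μ := ν) (ν := (volume : Measure (σ → ℝ))) (fun q => f q ^ 2), smul_eq_mul]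
  rw [e2] at h
  have h2 : mehlerForm a b f f * (ν.real Set.univ * μ₁) ≤
      ((∏ i, Real.sqrt (π / (a i + b i + π))) * (1 - θ) * ∫ x, f x ^ 2) * (ν.real Set.univ * μ₁) := h.trans (le_of_eq (by ring))
  exact le_of_mul_le_mul_right h2 (mul_pos (measureReal_univ_pos (μ := ν)) hμ₁)

/-- ★★ **CEILING of the tensor stiff constant**: `θ ≤ 1 − r_{k₀}` for EVERY mode (Schur-exact kernel, finite `ν ≠ 0`, `μ₁ > 0`). [cite: Wipf2021, §8.5.1 (8.58)] -/
theorem tensorStiff_le [IsFiniteMeasure ν] [NeZero ν] (ha : ∀ i, 0 < a i) (hb : ∀ i, 0 < b i) (hab : ∀ i, a i ^ 2 + 2 * a i * b i = π ^ 2)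
    (hk0 : ∀ c c', 0 ≤ k c c') (hksymm : ∀ c c', k c c' = k c' c) (hkm : Measurable (Function.uncurry k)) (hkint : ∀ c, Integrable (k c) ν)
    (hμ₁ : 0 < μ₁) (hkrow : ∀ c, ∫ c', k c c' ∂ν = μ₁)
    (hst : ∀ Φ : C × (σ → ℝ) → ℝ, MemLp Φ 2 (ν.prod volume) → (∀ c, slowCoeff Φ c = 0) →
      tensorForm ν k a b Φ Φ ≤ (∏ i, Real.sqrt (π / (a i + b i + π))) * (1 - θ) * μ₁ * ∫ p, Φ p ^ 2 ∂(ν.prod volume)) (k₀ : σ) :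
    θ ≤ 1 - b k₀ / (a k₀ + b k₀ + π) :=
  R60.stiffGap_le ha hb hab (fun _ hf hf0 => fibreStiff_of_tensorStiff ha (fun i => (hb i).le) hk0 hksymm hkm hkint hμ₁ hkrow hst hf hf0) k₀

/-- ★★ **Conversely** (any kernel with rows `≤ μ₁`, `μ₁ ≥ 0`, at least one stiff mode): if `θ ≤ 1 − r_{k₀}` for every mode, the tensor stiff clause holds at `θ` — by lane A's
`abs_tensorForm_sub_slow_le` at `ρ = min (1−θ) 1`. [cite: Luscher1983, §3] [cite: Helffer2013, Lemma 7.1] -/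
theorem tensorStiff_of_le [Nonempty σ] (ha : ∀ i, 0 < a i) (hb : ∀ i, 0 < b i) (hab : ∀ i, a i ^ 2 + 2 * a i * b i = π ^ 2)
    (hk0 : ∀ c c', 0 ≤ k c c') (hksymm : ∀ c c', k c c' = k c' c) (hkm : Measurable (Function.uncurry k)) (hkint : ∀ c, Integrable (k c) ν)
    (hμ₁ : 0 ≤ μ₁) (hkrow : ∀ c, ∫ c', k c c' ∂ν ≤ μ₁) (hθ : ∀ k₀, θ ≤ 1 - b k₀ / (a k₀ + b k₀ + π))
    {Φ : C × (σ → ℝ) → ℝ} (hΦ : MemLp Φ 2 (ν.prod volume)) (hΦ0 : ∀ c, slowCoeff Φ c = 0) :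
    tensorForm ν k a b Φ Φ ≤ (∏ i, Real.sqrt (π / (a i + b i + π))) * (1 - θ) * μ₁ * ∫ p, Φ p ^ 2 ∂(ν.prod volume) := by
  obtain ⟨hs, hL, hr⟩ := data_pos ha hb
  obtain ⟨k₁⟩ := ‹Nonempty σ›
  set ρ := min (1 - θ) 1 with hρdef
  have hρ1 : ρ ≤ 1 := min_le_right _ _
  have hρθ : ρ ≤ 1 - θ := min_le_left _ _
  have hrle : ∀ k₀, b k₀ / (a k₀ + b k₀ + π) ≤ ρ := fun k₀ => by
    refine le_min (by linarith [hθ k₀]) ?_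
    rw [div_le_one (hs k₀)]
    linarith [ha k₀, Real.pi_pos]
  have hρ0 : 0 ≤ ρ := (hr k₁).le.trans (hrle k₁)
  have h := abs_tensorForm_sub_slow_le ha hb hab hρ0 hrle hρ1 hk0 hksymm hkm hkint hμ₁ hkrow hΦ hΦ
  simp only [hΦ0, zero_mul, integral_zero, mul_zero, sub_zero] at h
  -- `∫ orthSq Φ = ‖Φ‖²` since `slowCoeff Φ ≡ 0`
  have hO : ∫ c, orthSq Φ c ∂ν = ∫ p, Φ p ^ 2 ∂(ν.prod volume) := by
    rw [integral_sq_eq_integral_fibreSq hΦ]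
    exact integral_congr_ae (ae_of_all _ fun c => by rw [orthSq, hΦ0, zero_pow two_ne_zero, sub_zero])
  have hN : 0 ≤ ∫ p, Φ p ^ 2 ∂(ν.prod volume) := integral_nonneg fun p => sq_nonneg _
  rw [hO, Real.mul_self_sqrt hN] at h
  refine ((le_abs_self _).trans h).trans ?_
  have hLμN : 0 ≤ (∏ i, Real.sqrt (π / (a i + b i + π))) * μ₁ * ∫ p, Φ p ^ 2 ∂(ν.prod volume) := by positivity
  nlinarith [hρθ, hLμN]

/-- ★★ **CHARACTERISATION of the tensor stiff constants (Schur-exact kernels)**: the clause `(∀ c, c₀(Φ(c,·)) = 0) ⇒ T(Φ,Φ) ≤ λ₀(1−θ)μ₁‖Φ‖²` holds for all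
`Φ ∈ L²(C × ℝ^σ)` IFF `θ ≤ 1 − r_{k₀}` for every mode — the admissible set is `(−∞, 1 − max_k r_k]`, IDENTICAL to the fibre's (`R60.mehlerGap_iff`): the slow tensor factor,
the pointwise (every-slow-point) orthogonality and the Markov normalisation change NOTHING. [cite: Luscher1983, §3] [cite: Wipf2021, §8.5.1 (8.58)] -/
theorem tensorStiff_iff [IsFiniteMeasure ν] [NeZero ν] [Nonempty σ] (ha : ∀ i, 0 < a i) (hb : ∀ i, 0 < b i) (hab : ∀ i, a i ^ 2 + 2 * a i * b i = π ^ 2)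
    (hk0 : ∀ c c', 0 ≤ k c c') (hksymm : ∀ c c', k c c' = k c' c) (hkm : Measurable (Function.uncurry k)) (hkint : ∀ c, Integrable (k c) ν)
    (hμ₁ : 0 < μ₁) (hkrow : ∀ c, ∫ c', k c c' ∂ν = μ₁) :
    (∀ Φ : C × (σ → ℝ) → ℝ, MemLp Φ 2 (ν.prod volume) → (∀ c, slowCoeff Φ c = 0) →
      tensorForm ν k a b Φ Φ ≤ (∏ i, Real.sqrt (π / (a i + b i + π))) * (1 - θ) * μ₁ * ∫ p, Φ p ^ 2 ∂(ν.prod volume)) ↔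
    ∀ k₀, θ ≤ 1 - b k₀ / (a k₀ + b k₀ + π) :=
  ⟨fun hst k₀ => tensorStiff_le ha hb hab hk0 hksymm hkm hkint hμ₁ hkrow hst k₀,
    fun hθ _ hΦ hΦ0 => tensorStiff_of_le ha hb hab hk0 hksymm hkm hkint hμ₁.le (fun c => (hkrow c).le) hθ hΦ hΦ0⟩

/-! ## §6 In the lattice normalisation: `θ₀ ≤ 1 − mehlerRatio g₀(L) ≤ 2π/L + (2π/L)²`; NO `L`-uniform tensor stiff constant; `θ₀ = 1/2` dies at `L = 9` -/

/-- ★★ **The tensor stiff ceiling at the vacuum stiff gap**: a Schur-exact model whose Mehler datum contains a mode normalised at `g₀(L) = 2 − 2cos(2π/L)` (`L > 0`;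
`…MehlerScaling.mehler_normalisation`) admits only tensor stiff constants `θ ≤ 2π/L + (2π/L)²`. [cite: Wipf2021, §8.5.1 (8.57)] [cite: Luscher1983, §3] -/
theorem tensorStiff_le_vacuum [IsFiniteMeasure ν] [NeZero ν] (ha : ∀ i, 0 < a i) (hb : ∀ i, 0 < b i) (hab : ∀ i, a i ^ 2 + 2 * a i * b i = π ^ 2)
    (hk0 : ∀ c c', 0 ≤ k c c') (hksymm : ∀ c c', k c c' = k c' c) (hkm : Measurable (Function.uncurry k)) (hkint : ∀ c, Integrable (k c) ν)
    (hμ₁ : 0 < μ₁) (hkrow : ∀ c, ∫ c', k c c' ∂ν = μ₁)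
    (hst : ∀ Φ : C × (σ → ℝ) → ℝ, MemLp Φ 2 (ν.prod volume) → (∀ c, slowCoeff Φ c = 0) →
      tensorForm ν k a b Φ Φ ≤ (∏ i, Real.sqrt (π / (a i + b i + π))) * (1 - θ) * μ₁ * ∫ p, Φ p ^ 2 ∂(ν.prod volume))
    {L : ℝ} (hL : 0 < L) (k₀ : σ) (hk₀ : b k₀ / (a k₀ + b k₀ + π) = mehlerRatio (2 - 2 * Real.cos (2 * π / L))) :
    θ ≤ 2 * π / L + (2 * π / L) ^ 2 :=
  R60.stiffGap_le_vacuum ha hb hab (fun _ hf hf0 => fibreStiff_of_tensorStiff ha (fun i => (hb i).le) hk0 hksymm hkm hkint hμ₁ hkrow hst hf hf0) hL k₀ hk₀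

/-- ★★★ **NO `L`-UNIFORM TENSOR STIFF CONSTANT.**  For every `θ > 0` there is `L₀` such that for all `L ≥ L₀`, every finite mode set with a normalised Mehler datum containing a
mode at the vacuum stiff gap `g₀(L)`, and EVERY slow model (any measurable space `C` with a finite measure `ν ≠ 0` and a Schur-exact kernel `k ≥ 0`, symmetric, rows `= μ₁ > 0`),
the tensor stiff clause with constant `θ` FAILS: some `Φ ∈ L²(C × ℝ^ι)`, fibre-orthogonal to the ground state at every slow point, has `T(Φ,Φ) > λ₀(1−θ)μ₁‖Φ‖²`.  (The
strengthening of (B-ST) to an `L`-independent `θ₀` is false in the full slow ⊗ stiff model, not only fibrewise.) [cite: Wipf2021, §8.5.1 (8.58)] [cite: Luscher1983, §3] -/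
theorem no_uniform_tensorStiff {θ : ℝ} (hθ : 0 < θ) :
    ∃ L₀ : ℕ, ∀ L : ℕ, L₀ ≤ L → ∀ (ι : Type) [Fintype ι] [DecidableEq ι] (a b : ι → ℝ),
      (∀ j, 0 < a j) → (∀ j, 0 < b j) → (∀ j, a j ^ 2 + 2 * a j * b j = π ^ 2) →
      ∀ k₀ : ι, b k₀ / (a k₀ + b k₀ + π) = mehlerRatio (2 - 2 * Real.cos (2 * π / L)) →
      ∀ (C : Type) [MeasurableSpace C] (ν : Measure C) [IsFiniteMeasure ν] [NeZero ν] (k : C → C → ℝ) (μ₁ : ℝ),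
      (∀ c c', 0 ≤ k c c') → (∀ c c', k c c' = k c' c) → Measurable (Function.uncurry k) → (∀ c, Integrable (k c) ν) → 0 < μ₁ →
      (∀ c, ∫ c', k c c' ∂ν = μ₁) →
      ¬ ∀ Φ : C × (ι → ℝ) → ℝ, MemLp Φ 2 (ν.prod volume) → (∀ c, slowCoeff Φ c = 0) →
        tensorForm ν k a b Φ Φ ≤ (∏ i, Real.sqrt (π / (a i + b i + π))) * (1 - θ) * μ₁ * ∫ p, Φ p ^ 2 ∂(ν.prod volume) := by
  obtain ⟨L₀, hL₀⟩ := R60.no_uniform_stiffGap hθ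
  refine ⟨L₀, fun L hL ι _ _ a b ha hb hab k₀ hk₀ C _ ν _ _ k μ₁ hk0 hksymm hkm hkint hμ₁ hkrow hst => ?_⟩
  exact hL₀ L hL ι a b ha hb hab k₀ hk₀
    (fun _ hf hf0 => fibreStiff_of_tensorStiff ha (fun i => (hb i).le) hk0 hksymm hkm hkint hμ₁ hkrow hst hf hf0)

/-- ★ **`θ₀ = 1/2` is inadmissible in the tensor model for every `L ≥ 9`.** [cite: Wipf2021, §8.5.1 (8.58)] [cite: Luscher1983, §3] -/
theorem tensorStiff_half_fails [IsFiniteMeasure ν] [NeZero ν] (ha : ∀ i, 0 < a i) (hb : ∀ i, 0 < b i) (hab : ∀ i, a i ^ 2 + 2 * a i * b i = π ^ 2)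
    (hk0 : ∀ c c', 0 ≤ k c c') (hksymm : ∀ c c', k c c' = k c' c) (hkm : Measurable (Function.uncurry k)) (hkint : ∀ c, Integrable (k c) ν)
    (hμ₁ : 0 < μ₁) (hkrow : ∀ c, ∫ c', k c c' ∂ν = μ₁)
    {L : ℝ} (hL : 9 ≤ L) (k₀ : σ) (hk₀ : b k₀ / (a k₀ + b k₀ + π) = mehlerRatio (2 - 2 * Real.cos (2 * π / L))) (hθ : 1 / 2 ≤ θ) :
    ¬ ∀ Φ : C × (σ → ℝ) → ℝ, MemLp Φ 2 (ν.prod volume) → (∀ c, slowCoeff Φ c = 0) →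
      tensorForm ν k a b Φ Φ ≤ (∏ i, Real.sqrt (π / (a i + b i + π))) * (1 - θ) * μ₁ * ∫ p, Φ p ^ 2 ∂(ν.prod volume) := fun hst =>
  R60.stiffGap_half_fails ha hb hab hL k₀ hk₀ hθ
    (fun _ hf hf0 => fibreStiff_of_tensorStiff ha (fun i => (hb i).le) hk0 hksymm hkm hkint hμ₁ hkrow hst hf hf0)

end Stiff

end Summit.QuantumFields.YangMills.Theorems.TwistedTraceScaling.Negative.R61

end
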